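import Mathlib
import HarnessLib
import Summits.RiemannHypothesis.RiemannHypothesis.Theorems.MayerPairingBranchPairingFiniteSetSelectionGlue
import Summits.RiemannHypothesis.RiemannHypothesis.Theorems.MayerPairingBranchPairingFiniteSetSelectionPatch

/-!
# Crux `MayerPairing.BranchPairing` (stmt-RiemannHypothesis-1471), line `weinstein-aronszajn-pinning`:
continuous selection of a finite-set-valued map (STUB 2b, `finiteSetSelection_main`)

Route `RiemannHypothesis/MayerPairing`, crux `BranchPairing` (item stmt-RiemannHypothesis-1471), line
`weinstein-aronszajn-pinning`; supports 1471. This file proves the registered sub-goal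
`finiteSetSelection_main` = the expanded form of the stub `stub_finiteSetSelection : FiniteSetSelection`
of the checked skeleton: Kato's theorem "the eigenvalues of a continuous `N × N` family over a real
interval can be represented by `N` continuous functions" (T. Kato, *Perturbation theory for linear
operators* (1966), II-§5.2 Thm. 5.2) in SET form — for `S : ℝ → Set ℂ` nonempty- and finite-valued
(at most `n` points) over `[a, b]`, with closed bounded graph and lower semicontinuous, through every
point of the graph passes a continuous selection on `[a, b]`. The statement is `ζ`-free and
operator-free; with `TubeSpectrumData` (file `…TubeSpectrumData.lean`) it yields `KatoSelection` via
the kernel-checked glue `katoSelection_of`.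

Proof (induction on `n`, files `…FiniteSetSelectionGlue.lean`, `…FiniteSetSelectionPatch.lean` and
this one). Clamp `S` to `S̃ σ := S (projIcc a b σ)` and let `G := {σ | S̃ σ has ≤ 1 point} ∪
(ℝ ∖ (a - 1, b + 1))`, a closed set (`isClosed_setOf_subsingleton_projIcc`, from lower
semicontinuity) with bounded complement. Off `G` the clamped map has the patch property
(`finiteSetSelectionPatch_main`: locally the values split into `≥ 2` separated clusters of `≤ n - 1`
points, to which the induction hypothesis applies). The gluing layer
(`exists_selection_component`) then gives one continuous selection per component of `ℝ ∖ G`, and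
`exists_selection_continuousAt_compl` assembles them with the forced value on `G` into a global
selection continuous off `G`; at points of `G ∩ [a, b]` the value set is a singleton and continuity
is automatic by upper semicontinuity (`exists_forall_dist_lt_of_isClosed_graph`).
-/

open Set Filter Topology Metric

namespace Summit.RiemannHypothesis.RiemannHypothesis.Theorems.MayerPairingPinning

/-! ### The singleton set and the global assembly -/

/-- **The singleton set is closed.** Under the lower semicontinuity hypothesis, the set of `σ`
at which `S (projIcc a b σ)` has at most one point is closed: two distinct points of `S σ₀`
persist as two distinct nearby points of `S σ` for `σ` near `σ₀`. [folklore] -/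
theorem isClosed_setOf_subsingleton_projIcc {S : ℝ → Set ℂ} {a b : ℝ} (hab : a ≤ b)
    (hL : ∀ σ₀ ∈ Icc a b, ∀ μ₀ ∈ S σ₀, ∀ ε > (0 : ℝ), ∃ η > (0 : ℝ), ∀ σ ∈ Icc a b,
      |σ - σ₀| < η → ∃ μ ∈ S σ, ‖μ - μ₀‖ < ε) :
    IsClosed {σ : ℝ | (S (projIcc a b hab σ)).Subsingleton} := by
  rw [← isOpen_compl_iff, Metric.isOpen_iff]
  intro σ₀ hσ₀
  obtain ⟨p, hp, q, hq, hpq⟩ := not_subsingleton_iff.1 hσ₀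
  have hd : 0 < dist p q / 2 := half_pos (dist_pos.2 hpq)
  obtain ⟨η₁, hη₁, h₁⟩ := hL _ (projIcc a b hab σ₀).2 p hp _ hd
  obtain ⟨η₂, hη₂, h₂⟩ := hL _ (projIcc a b hab σ₀).2 q hq _ hd
  refine ⟨min η₁ η₂, lt_min hη₁ hη₂, fun σ hσ => ?_⟩
  have hστ : |(projIcc a b hab σ : ℝ) - projIcc a b hab σ₀| < min η₁ η₂ :=
    lt_of_le_of_lt (abs_projIcc_sub_projIcc hab) (by rw [← Real.dist_eq]; exact mem_ball.1 hσ)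
  obtain ⟨μp, hμp, hμp'⟩ := h₁ _ (projIcc a b hab σ).2 (hστ.trans_le (min_le_left _ _))
  obtain ⟨μq, hμq, hμq'⟩ := h₂ _ (projIcc a b hab σ).2 (hστ.trans_le (min_le_right _ _))
  rw [mem_compl_iff, mem_setOf_eq]
  intro hsub
  have heq : μp = μq := hsub hμp hμq
  rw [heq, ← dist_eq_norm] at hμp'
  rw [← dist_eq_norm] at hμq'
  linarith [dist_triangle p μq q, dist_comm p μq]

/-- **Global assembly.** Let `G ⊆ ℝ` be closed with bounded complement, `S` nonempty-valued with
the patch property off `G`. Then through any point `(σ₁, μ₁)` of the graph (with `S σ₁` a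
singleton if `σ₁ ∈ G`) there is a global selection `Λ` of `S` (`Λ σ ∈ S σ` for all `σ`) which is
continuous at every point off `G`: one selection per component of `ℝ ∖ G` (chosen through
`(σ₁, μ₁)` on the component of `σ₁`), and an arbitrary point of `S σ` at `σ ∈ G`. Continuity at the
points of `G` is not asserted (it holds wherever `S` is upper semicontinuous with singleton value).
[folklore] -/
theorem exists_selection_continuousAt_compl {S : ℝ → Set ℂ} {G : Set ℝ} (hGc : IsClosed G)
    {p q : ℝ} (hbdd : ∀ σ, σ ∉ G → σ ∈ Icc p q) (hne : ∀ σ, (S σ).Nonempty)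
    (hloc : ∀ σ₀, σ₀ ∉ G → ∃ η > (0 : ℝ), ∀ σ' ∈ Icc (σ₀ - η) (σ₀ + η), ∀ μ' ∈ S σ',
      ∃ Λ : ℝ → ℂ, ContinuousOn Λ (Icc (σ₀ - η) (σ₀ + η)) ∧ Λ σ' = μ' ∧
        ∀ σ ∈ Icc (σ₀ - η) (σ₀ + η), Λ σ ∈ S σ)
    {σ₁ : ℝ} {μ₁ : ℂ} (hμ₁ : μ₁ ∈ S σ₁) (hσ₁ : σ₁ ∈ G → (S σ₁).Subsingleton) :
    ∃ Λ : ℝ → ℂ, (∀ σ, Λ σ ∈ S σ) ∧ Λ σ₁ = μ₁ ∧ ∀ σ, σ ∉ G → ContinuousAt Λ σ := by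
  classical
  -- `cls σ` = the points joined to `σ` by a segment missing `G`
  set cls : ℝ → Set ℝ := fun σ => {τ | ∀ t ∈ uIcc σ τ, t ∉ G} with hcls
  have hself : ∀ σ, σ ∉ G → σ ∈ cls σ := fun σ hσ t ht => by
    rw [uIcc_self, mem_singleton_iff] at ht; rwa [ht]
  have hcls_eq : ∀ σ τ, τ ∈ cls σ → cls τ = cls σ := by
    intro σ τ hστ
    ext x
    simp only [hcls, mem_setOf_eq]
    constructor
    · intro hx t ht
      rcases uIcc_subset_uIcc_union_uIcc ht with h | h
      · exact hστ t h
      · exact hx t h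
    · intro hx t ht
      rcases uIcc_subset_uIcc_union_uIcc ht with h | h
      · exact hστ t (by rwa [uIcc_comm] at h)
      · exact hx t h
  -- `good C Λ`: `Λ` is a selection on `C`, continuous at its points, through `(σ₁, μ₁)` if due
  set good : Set ℝ → (ℝ → ℂ) → Prop := fun C Λ =>
    (σ₁ ∈ C → Λ σ₁ = μ₁) ∧ ∀ τ ∈ C, ContinuousAt Λ τ ∧ Λ τ ∈ S τ with hgood
  have hex : ∀ σ, σ ∉ G → ∃ Λ, good (cls σ) Λ := by
    intro σ hσ
    by_cases h1 : σ₁ ∈ cls σ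
    · have hσ₁G : σ₁ ∉ G := h1 σ₁ right_mem_uIcc
      obtain ⟨Λ, hΛ1, hΛ2⟩ := exists_selection_component hGc hbdd hloc hσ₁G hμ₁
      refine ⟨Λ, fun _ => hΛ1, fun τ hτ => hΛ2 τ ?_⟩
      have hτ' : τ ∈ cls σ₁ := by rwa [hcls_eq σ σ₁ h1]
      exact hτ'
    · obtain ⟨Λ, -, hΛ2⟩ := exists_selection_component hGc hbdd hloc hσ (hne σ).some_mem
      exact ⟨Λ, fun h => absurd h h1, fun τ hτ => hΛ2 τ hτ⟩
  set secOf : Set ℝ → ℝ → ℂ := fun C => if h : ∃ Λ, good C Λ then h.choose else fun _ => 0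
    with hsecOf
  have hsec : ∀ σ, σ ∉ G → good (cls σ) (secOf (cls σ)) := fun σ hσ => by
    simp only [hsecOf, dif_pos (hex σ hσ)]
    exact (hex σ hσ).choose_spec
  refine ⟨fun σ => if σ ∈ G then (hne σ).some else secOf (cls σ) σ, fun σ => ?_, ?_,
    fun σ₀ hσ₀ => ?_⟩
  · show (if σ ∈ G then (hne σ).some else secOf (cls σ) σ) ∈ S σ
    by_cases hσ : σ ∈ G
    · rw [if_pos hσ]; exact (hne σ).some_mem
    · rw [if_neg hσ]; exact ((hsec σ hσ).2 σ (hself σ hσ)).2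
  · show (if σ₁ ∈ G then (hne σ₁).some else secOf (cls σ₁) σ₁) = μ₁
    by_cases h : σ₁ ∈ G
    · rw [if_pos h]; exact hσ₁ h (hne σ₁).some_mem hμ₁
    · rw [if_neg h]; exact (hsec σ₁ h).1 (hself σ₁ h)
  · obtain ⟨ρ, hρ, hball⟩ := Metric.isOpen_iff.1 hGc.isOpen_compl σ₀ hσ₀
    have hmem : ∀ σ ∈ ball σ₀ ρ, σ ∈ cls σ₀ := fun σ hσ t ht =>
      hball (mem_ball.2 (lt_of_le_of_lt
        (by rw [dist_comm]; exact Real.dist_left_le_of_mem_uIcc ht) (mem_ball'.1 hσ)))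
    have heq : ∀ σ ∈ ball σ₀ ρ,
        (fun σ => if σ ∈ G then (hne σ).some else secOf (cls σ) σ) σ = secOf (cls σ₀) σ := by
      intro σ hσ
      have hσG : σ ∉ G := hball hσ
      dsimp only
      rw [if_neg hσG, hcls_eq σ₀ σ (hmem σ hσ)]
    exact ((hsec σ₀ hσ₀).2 σ₀ (hself σ₀ hσ₀)).1.congr
      (eventuallyEq_of_mem (ball_mem_nhds σ₀ hρ) fun σ hσ => (heq σ hσ).symm)

/-! ### The theorem -/

/-- **Kato's selection theorem in set form** (registered sub-goal `finiteSetSelection_main` of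
crux `BranchPairing`, stmt-RiemannHypothesis-1471, line `weinstein-aronszajn-pinning`). Let
`S : ℝ → Set ℂ` be, over `[a, b]`, nonempty- and finite-valued with at most `n` points, with
closed bounded graph, and lower semicontinuous. Then through every point `(σ₁, μ₁)` of the graph
passes a continuous selection `Λ` of `S` on `[a, b]`. This is T. Kato, *Perturbation theory for
linear operators* (1966), II-§5.2 Thm. 5.2 ("the eigenvalues of a continuous family `T(x)`,
`x` real, can be represented by `N` continuous functions") with the unordered `N`-tuple replaced by
its underlying set. Proof by induction on `n`: off the closed set `Γ` where `S` is a singleton, the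
values split locally into `≥ 2` separated clusters of `≤ n - 1` points each (induction: the patch
property), selections are continued along components of the complement of `Γ` and glued across
`Γ`, where continuity is automatic by upper semicontinuity (Kato 1966, II-§5.2 Thm. 5.2 and its
proof). -/
theorem finiteSetSelection_main : ∀ (n : ℕ) (S : ℝ → Set ℂ) (a b : ℝ), a ≤ b → (∀ σ ∈ Set.Icc a b, (S σ).Nonempty) → (∀ σ ∈ Set.Icc a b, ∃ F : Finset ℂ, (↑F : Set ℂ) = S σ ∧ F.card ≤ n) → IsClosed {p : ℝ × ℂ | p.1 ∈ Set.Icc a b ∧ p.2 ∈ S p.1} → (∃ R : ℝ, ∀ σ ∈ Set.Icc a b, ∀ μ ∈ S σ, ‖μ‖ ≤ R) → (∀ σ₀ ∈ Set.Icc a b, ∀ μ₀ ∈ S σ₀, ∀ ε > (0 : ℝ), ∃ η > (0 : ℝ), ∀ σ ∈ Set.Icc a b, |σ - σ₀| < η → ∃ μ ∈ S σ, ‖μ - μ₀‖ < ε) → ∀ σ₁ ∈ Set.Icc a b, ∀ μ₁ ∈ S σ₁, ∃ Λ : ℝ → ℂ, ContinuousOn Λ (Set.Icc a b) ∧ Λ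 σ₁ = μ₁ ∧ ∀ σ ∈ Set.Icc a b, Λ σ ∈ S σ := by
  intro n
  induction n with
  | zero =>
    intro S a b hab hNE hC hK hB hL σ₁ hσ₁ μ₁ hμ₁
    obtain ⟨F, hF, hcard⟩ := hC σ₁ hσ₁
    rw [Nat.le_zero, Finset.card_eq_zero] at hcard
    rw [hcard, Finset.coe_empty] at hF
    rw [← hF] at hμ₁
    exact absurd hμ₁ (notMem_empty μ₁)
  | succ n ih =>
    intro S a b hab hNE hC hK hB hL σ₁ hσ₁ μ₁ hμ₁
    -- upper semicontinuity from the compact graph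
    have hU : ∀ σ₀, ∀ ε > (0 : ℝ), ∃ δ > (0 : ℝ), ∀ σ ∈ Icc a b, |σ - σ₀| < δ →
        ∀ μ ∈ S σ, ∃ μ' ∈ S σ₀, dist μ μ' < ε :=
      fun σ₀ ε hε => exists_forall_dist_lt_of_isClosed_graph hK hB σ₀ hε
    -- the clamped map `σ ↦ S (projIcc a b σ)` and the bad set `G`
    set G : Set ℝ := {σ | (S (projIcc a b hab σ)).Subsingleton} ∪ (Ioo (a - 1) (b + 1))ᶜ with hG
    have hGc : IsClosed G :=
      (isClosed_setOf_subsingleton_projIcc hab hL).union isOpen_Ioo.isClosed_compl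
    have hbdd : ∀ σ, σ ∉ G → σ ∈ Icc (a - 1) (b + 1) := fun σ hσ => by
      rw [hG, mem_union, not_or, mem_compl_iff, not_not] at hσ
      exact Ioo_subset_Icc_self hσ.2
    have hne : ∀ σ, (S (projIcc a b hab σ)).Nonempty := fun σ => hNE _ (projIcc a b hab σ).2
    -- the patch property off `G`: the localised induction step
    have hloc : ∀ σ₀, σ₀ ∉ G → ∃ η > (0 : ℝ), ∀ σ' ∈ Icc (σ₀ - η) (σ₀ + η),
        ∀ μ' ∈ S (projIcc a b hab σ'), ∃ Λ : ℝ → ℂ, ContinuousOn Λ (Icc (σ₀ - η) (σ₀ + η)) ∧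
          Λ σ' = μ' ∧ ∀ σ ∈ Icc (σ₀ - η) (σ₀ + η), Λ σ ∈ S (projIcc a b hab σ) :=
      fun σ₀ hσ₀ => finiteSetSelectionPatch_main n S a b hab ih hC hK hB hL σ₀ (by
        rw [hG, mem_union, not_or] at hσ₀
        exact not_subsingleton_iff.1 hσ₀.1)
    -- the singleton property at points of `G ∩ [a, b]`
    have hGsub : ∀ σ ∈ Icc a b, σ ∈ G → (S σ).Subsingleton := fun σ hσ hσG => by
      rw [hG, mem_union] at hσG
      rcases hσG with h | h
      · simpa only [mem_setOf_eq, projIcc_of_mem hab hσ] using h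
      · exact absurd (⟨by linarith [hσ.1], by linarith [hσ.2]⟩ : σ ∈ Ioo (a - 1) (b + 1)) h
    have hμ₁' : μ₁ ∈ S (projIcc a b hab σ₁) := by rwa [projIcc_of_mem hab hσ₁]
    obtain ⟨Λ, hΛS, hΛv, hΛc⟩ := exists_selection_continuousAt_compl hGc hbdd hne hloc hμ₁'
      (fun h => by rw [projIcc_of_mem hab hσ₁]; exact hGsub σ₁ hσ₁ h)
    have hΛS' : ∀ σ ∈ Icc a b, Λ σ ∈ S σ := fun σ hσ => by
      simpa only [projIcc_of_mem hab hσ] using hΛS σ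
    refine ⟨Λ, fun σ₀ hσ₀ => ?_, hΛv, hΛS'⟩
    by_cases hσ₀G : σ₀ ∈ G
    · -- at a singleton point: continuity from upper semicontinuity
      have hss := hGsub σ₀ hσ₀ hσ₀G
      rw [Metric.continuousWithinAt_iff]
      intro ε hε
      obtain ⟨δ, hδ, h⟩ := hU σ₀ ε hε
      refine ⟨δ, hδ, fun {σ} hσ hσd => ?_⟩
      obtain ⟨μ', hμ', hd⟩ := h σ hσ (by rwa [← Real.dist_eq]) (Λ σ) (hΛS' σ hσ)
      rwa [hss hμ' (hΛS' σ₀ hσ₀)] at hd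
    · exact (hΛc σ₀ hσ₀G).continuousWithinAt

end Summit.RiemannHypothesis.RiemannHypothesis.Theorems.MayerPairingPinning
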